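import Literature.NumberTheory.LFunctions.RademacherDirichletLConvexity
import Literature.NumberTheory.LFunctions.DirichletThetaTransformation
import Literature.NumberTheory.LFunctions.DirichletLFunctionZeroFreeRegion
import HarnessLib

/-!
# Booker's uniform convexity bound for Dirichlet `L`-functions (Experiment. Math. 15 (2006), Lemma 4.1)

Topic `Literature/NumberTheory/LFunctions`; namespace `Literature.NumberTheory.LFunctions`, engine
sub-namespace `BookerConvexity`. Everything in this file is PROVED (no named fact, no new definition).
Typed for the parity-realchar cell (D-0088 (4) literature-typing layer, row «Booker 2006 (Artin, Turing,
class numbers)»): instrument provenance for Turing's method for `L(s, χ)` (TARGET row 24; companion of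
`CertifiedDirichletLTuringBooker.lean`, which records that its upper bound DEVIATES from the source by
using Rademacher's theorem in place of Lemma 4.1 — the lemma itself was not in the tree) and the input
"Lemmas 4.1 and 4.5 imply the bound `|F(t)| ≤ E`" of Booker's Lemma 5.7 (`CertifiedLFunctionTimeAliasingBound.lean`).

Source: A. R. Booker, *Artin's conjecture, Turing's method, and the Riemann hypothesis*, Experiment.
Math. **15** (2006) 385–407 [Booker2006], §4 Lemma 4.1 with proof = arXiv:math/0507502v1 §4, first lemma
(LaTeX source `turing.tex` ll. 966–1035; held text `paper:arxiv-math_0507502` chunk 13, ll. 28–96 —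
statement and proof read there). Printed (general degree `r`): "**Lemma 4.1.** Let notation be as above,
and set `B := sup_{Re(s)=3/2} |L(s)|²`. Then, for `s` in the strip `{s ∈ ℂ : −½ ≤ Re(s) ≤ 3/2}`,
`|L(s)|² ≤ B |χ(s)Q(s)| |P(s+1)²P(s−2)/(P(s)²P(s−1))|`." Here `Q(s) = N Π_j (s+μ_j)/(2π)` is the analytic
conductor, `γ(s+2) = Q(s)γ(s)`, `χ(s) := γ̄(1−s)/γ(s)` "so that `L(s) = χ(s)L̄(1−s)`", and `P` collects
the poles `1 + λ_k` of `L`. Proof (entire case): "Set `F(s) := L(s)L̄(1−s) = χ(s)^{−1}L(s)²` …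
`|F(3/2+it)| = |L(3/2+it)|²|Q(−1/2+it)| ≤ B|Q(3/2+it)|` … `|F(σ+it)| = |F(1−σ+it)|`. Hence
`|F(−1/2+it)| ≤ B|Q(−1/2+it)|`. Thus `F(s)/Q(s)` is bounded by `B` on the lines `Re(s) = −½` and
`Re(s) = 3/2`. Note that although `Q(s)` has zeros, `F(s)` has trivial zeros at the same points … Since
`F` has finite order, it follows from the Phragmén–Lindelöf theorem that `|F(s)| ≤ B|Q(s)|` for all `s`
in the strip."

## What is typed (degree one)

For a primitive Dirichlet character `χ` modulo `q > 1`: `r = 1`, `N = q`, `μ₁ = a = charParity χ`,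
`Q(s) = q(s+a)/(2π)`, `P = 1` (no poles), `L̄(s) = L(s, χ̄)` with `χ̄ = χ⁻¹`. The theorem
`booker2006_lemma41_dirichlet` is the sentence the printed proof establishes, `|F(s)| ≤ B|Q(s)|`:
`‖L(s, χ) L(1−s, χ̄)‖ ≤ B · q‖s + a‖/(2π)` on `−½ ≤ Re s ≤ 3/2`, with `B` any bound for `|L(3/2+it, χ)|²`
(the printed `B` is the supremum; any larger `B` is the same statement weakened). This `F`-form is
equivalent to the displayed `|L(s)|² ≤ B|χ(s)Q(s)|` wherever `χ(s) = L(s)/L̄(1−s)` is finite and nonzero,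
and avoids the pole of `χ(s)` at `s = 1 + a` (inside the strip for even `χ`), where Lean's junk value
`Γ(0) = 0` would falsify a literal transcription. Corollaries: the critical-line form
`|L(½+it, χ)|² ≤ B|Q(½+it)|` (`booker2006_lemma41_dirichlet_criticalLine`; `|χ(½+it)| = 1`) and, with
Lemma 4.5 (`|L(3/2+it)| ≤ ζ(3/2)`, the tree's `Booker2006Turing.norm_LFunction_le_bigZ`), the majorant
`|L(½+it, χ)| ≤ Z₀(3/2)|Q(½+it)|^{1/2}` of Lemma 5.7 (`BookerConvexity.norm_LFunction_half_le_bigZ_mul_sqrt`).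

## Method (the printed proof, r = 1)

`F(s) = L(s, χ)L(1−s, χ⁻¹)` is entire (`χ, χ⁻¹ ≠ 1`); `F(−a) = 0` (`L(0, χ) = −χ(0)/2 = 0` for even `χ`,
`L(−1, χ) = 0` for odd `χ`), so `g := dslope F (−a) = F(s)/(s+a)` is entire (Mathlib's
`Complex.differentiableOn_dslope`) — this is "`F/Q` is holomorphic". On `Re s = −½` the functional
equation in modulus (the tree's `Rademacher1959.norm_LFunction_eq_reflect`) has `Γ`-quotient
`|Γ(conj w + 1)/Γ(w)| = |w|`, `w = (s+a)/2`, i.e. `|L(s, χ)| = (q/2π)|s+a| |L(1−s, χ̄)|`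
(`BookerConvexity.norm_LFunction_left_edge`; this is `γ(s+2) = Q(s)γ(s)`); with
`L(s̄, χ̄) = conj L(s, χ)` (the tree's `DirichletZFR.conj_LFunction_conj`) this gives `|g| ≤ Bq/(2π)` on both
edges (on `Re s = 3/2` also `|−½ + a + it| ≤ |3/2 + a + it|`, the printed "since `Re(μ_j) ≥ −½`").
Finite order: `|L(z, χ)| ≤ 25qZ exp((q+7)(1+|z|)²)` (the tree's `SelbergDirichlet.norm_LFunction_le_exp`) on
the strip for both factors, `t² ≤ 4e^{|t|}`, and a compactness bound for `g` on `|Im z| ≤ 1`.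
Phragmén–Lindelöf: the tree's `Rademacher.norm_le_interpolate` (Rademacher 1959 Thm 2) with both
exponents `0`. Finally `|F(s)| = |s + a| |g(s)|`.

`lean search` / tree inventory (2026-08-27): Lemma 4.1 was not in the tree (named as "DEVIATION" in
`CertifiedDirichletLTuringBooker.lean`); used: `Rademacher1959.norm_LFunction_eq_reflect`,
`Rademacher.norm_le_interpolate`, `SelbergDirichlet.norm_LFunction_le_exp`, `SelbergDirichlet.isPrimitive_inv`,
`DirichletZFR.conj_LFunction_conj`, `DirichletTheta.charParity_inv`, `Booker2006Turing.norm_LFunction_le_bigZ`,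
Mathlib's `dslope`, `ZMod.LFunction_apply_zero_of_even`, `DirichletCharacter.Odd.LFunction_neg_two_mul_nat_sub_one`.
Nothing is restated.

## References

* [Booker2006] A. R. Booker, *Artin's conjecture, Turing's method, and the Riemann hypothesis*,
  Experiment. Math. 15 (2006) 385–407: §4 Lemma 4.1 and its proof (arXiv:math/0507502v1 §4).
* [Rademacher1959] H. Rademacher, *On the Phragmén–Lindelöf theorem and some applications*, Math. Z. 72
  (1959) 192–204: Theorem 2 (the interpolation theorem used for the Phragmén–Lindelöf step).
-/

noncomputable section

open Complex Filter Topology Set DirichletCharacter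
open scoped Real

namespace Literature.NumberTheory.LFunctions

namespace BookerConvexity

variable {q : ℕ} [NeZero q]

/-- The trivial zero used in Booker's proof ("although `Q(s)` has zeros, `F(s)` has trivial zeros at the
same points"): `L(−a, χ) = 0` for a primitive `χ` modulo `q > 1`, `a = charParity χ` (`L(0, χ) = −χ(0)/2 = 0`
for even `χ`, `L(−1, χ) = 0` for odd `χ`). [folklore] -/
private theorem LFunction_neg_charParity (hq : 1 < q) (χ : DirichletCharacter ℂ q) :
    χ.LFunction (-(charParity χ : ℂ)) = 0 := by
  rcases χ.even_or_odd with he | ho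
  · rw [charParity_of_even he, Nat.cast_zero, neg_zero]
    have h0 : χ 0 = 0 := by
      have : ¬ IsUnit (0 : ZMod q) := by
        rw [isUnit_zero_iff]
        haveI : Fact (1 < q) := ⟨hq⟩
        exact zero_ne_one
      exact MulChar.map_nonunit χ this
    show ZMod.LFunction χ 0 = 0
    rw [ZMod.LFunction_apply_zero_of_even he.to_fun, h0]; simp
  · rw [charParity_of_odd ho, Nat.cast_one]
    have := ho.LFunction_neg_two_mul_nat_sub_one 0
    simpa using this

/-- `‖Γ(conj w + 1) / Γ(w)‖ = ‖w‖` for `w` not a pole of `Γ` (`Γ(z+1) = zΓ(z)`, `|Γ(z̄)| = |Γ(z)|`).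
[folklore] -/
private theorem norm_Gamma_conj_add_one_div {w : ℂ} (hw : ∀ m : ℕ, w ≠ -m) :
    ‖Complex.Gamma ((starRingEnd ℂ) w + 1) / Complex.Gamma w‖ = ‖w‖ := by
  have hΓ : Complex.Gamma w ≠ 0 := Complex.Gamma_ne_zero hw
  have hw0 : (starRingEnd ℂ) w ≠ 0 := by
    intro h
    have : w = 0 := by simpa using congrArg (starRingEnd ℂ) h
    exact hw 0 (by simpa using this)
  rw [Complex.Gamma_add_one _ hw0, Complex.Gamma_conj, norm_div, norm_mul, Complex.norm_conj,
    Complex.norm_conj, mul_div_assoc, div_self (norm_ne_zero_iff.mpr hΓ), mul_one]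

/-- The reflection step of Booker's proof on the two edges, degree one: for `χ` primitive mod `q > 1`,
`σ ∈ {−1/2, 3/2}`... precisely, for every `s` with `Re s = −1/2`:
`‖L(s, χ)‖ = (q/2π) ‖s + a‖ ‖L(1 − s, χ̄)‖` (`a = charParity χ`; the `Γ`-quotient of the functional
equation at `σ = −1/2` is `|(s+a)/2|`, i.e. `γ(s+2) = Q(s)γ(s)`). [cite: Booker2006, proof of Lemma 4.1] -/
theorem norm_LFunction_left_edge (hq : 1 < q) {χ : DirichletCharacter ℂ q} (hχ : χ.IsPrimitive)
    {s : ℂ} (hs : s.re = -1 / 2) :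
    ‖χ.LFunction s‖ = (q : ℝ) / (2 * π) * ‖s + charParity χ‖ * ‖χ⁻¹.LFunction (1 - s)‖ := by
  have hqR : (0 : ℝ) < q := by exact_mod_cast (by omega : 0 < q)
  rw [Rademacher1959.norm_LFunction_eq_reflect hq hχ (by rw [hs]; norm_num)]
  set w : ℂ := ((charParity χ : ℂ) + s) / 2 with hw
  have hwre : w.re = ((charParity χ : ℝ) - 1 / 2) / 2 := by
    simp only [hw, Complex.div_ofNat_re, Complex.add_re, Complex.natCast_re, hs]; ring
  have hwim : w.im = s.im / 2 := by
    simp only [hw, Complex.div_ofNat_im, Complex.add_im, Complex.natCast_im]; ring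
  have e1 : (charParity χ : ℂ) / 2 + (1 - s) / 2 = (starRingEnd ℂ) w + 1 := by
    apply Complex.ext
    · simp only [Complex.add_re, Complex.div_ofNat_re, Complex.natCast_re, Complex.sub_re,
        Complex.one_re, hs, Complex.conj_re, hwre]; ring
    · simp only [Complex.add_im, Complex.div_ofNat_im, Complex.natCast_im, Complex.sub_im,
        Complex.one_im, Complex.conj_im, hwim]; ring
  have e2 : (charParity χ : ℂ) / 2 + s / 2 = w := by rw [hw]; ring
  have hwne : ∀ m : ℕ, w ≠ -m := by
    intro m h
    have h1 := congrArg Complex.re h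
    rw [hwre] at h1
    simp only [Complex.neg_re, Complex.natCast_re] at h1
    have ha := charParity_le_one χ
    have hm : (0 : ℝ) ≤ m := Nat.cast_nonneg m
    interval_cases (charParity χ)
    · simp only [Nat.cast_zero] at h1
      have h4 : ((4 * m : ℕ) : ℝ) = ((1 : ℕ) : ℝ) := by push_cast; linarith
      have := (Nat.cast_inj (R := ℝ)).mp h4
      omega
    · simp only [Nat.cast_one] at h1
      linarith
  rw [e1, e2, norm_Gamma_conj_add_one_div hwne, hw, norm_div, hs]
  have : ‖(2 : ℂ)‖ = 2 := by simp
  rw [this, show (π / q : ℝ) ^ (-1 / 2 - 1 / 2 : ℝ) = q / π by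
    rw [show (-1 / 2 - 1 / 2 : ℝ) = -1 by norm_num, Real.rpow_neg_one, inv_div], add_comm]
  ring

/-- `t² ≤ 4 e^{|t|}` (from `1 + x ≤ eˣ` at `x = |t|/2`). [folklore] -/
private lemma sq_le_four_mul_exp_abs (t : ℝ) : t ^ 2 ≤ 4 * Real.exp |t| := by
  have h1 : |t| / 2 + 1 ≤ Real.exp (|t| / 2) := Real.add_one_le_exp _
  have h2 : 0 ≤ |t| / 2 := by positivity
  have h3 : (|t| / 2) ^ 2 ≤ Real.exp (|t| / 2) ^ 2 := pow_le_pow_left₀ h2 (by linarith) 2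
  have h4 : Real.exp (|t| / 2) ^ 2 = Real.exp |t| := by rw [sq, ← Real.exp_add]; ring_nf
  have h5 : t ^ 2 = 4 * (|t| / 2) ^ 2 := by rw [div_pow, ← sq_abs t]; ring
  rw [h5, ← h4]
  linarith

/-- A crude finite-order bound for `L(z, χ)` on `|Re z| ≤ 3/2`: `‖L(z, χ)‖ ≤ K₀ exp(29(q+7) e^{|t|})`,
`K₀ = 25 q Σ (n+1)^{-3/2}` (from `SelbergDirichlet.norm_LFunction_le_exp`). [folklore] -/
private lemma norm_LFunction_le_growth (hq : 1 < q) {χ : DirichletCharacter ℂ q} (hχ : χ.IsPrimitive)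
    {z : ℂ} (h1 : -3 / 2 ≤ z.re) (h2 : z.re ≤ 3 / 2) :
    ‖χ.LFunction z‖ ≤ 25 * q * (∑' n : ℕ, ((n + 1 : ℕ) : ℝ) ^ (-(1 / 2 : ℝ) - 1)) *
      Real.exp (29 * (q + 7) * Real.exp |z.im|) := by
  have hq1 : q ≠ 1 := by omega
  refine (SelbergDirichlet.norm_LFunction_le_exp hχ hq1 z).trans ?_
  refine mul_le_mul_of_nonneg_left (Real.exp_le_exp.mpr ?_) (by positivity)
  have hn2 : ‖z‖ ^ 2 ≤ 9 / 4 + z.im ^ 2 := by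
    rw [Complex.sq_norm, Complex.normSq_apply]
    have : z.re ^ 2 ≤ (3 / 2 : ℝ) ^ 2 := sq_le_sq' (by linarith) (by linarith)
    nlinarith
  have h1e : 1 ≤ Real.exp |z.im| := Real.one_le_exp (abs_nonneg _)
  have ht := sq_le_four_mul_exp_abs z.im
  have hq0 : (0 : ℝ) ≤ q := Nat.cast_nonneg q
  nlinarith [norm_nonneg z, mul_nonneg hq0 (norm_nonneg z)]

/-- **Booker 2006, Lemma 4.1 (Experiment. Math. 15 (2006), §4; arXiv:math/0507502v1 §4), degree one —
the uniform convexity bound.** Printed (general degree `r`): "Let notation be as above, and set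
`B := sup_{Re(s) = 3/2} |L(s)|²`. Then, for `s` in the strip `{−½ ≤ Re(s) ≤ 3/2}`,
`|L(s)|² ≤ B |χ(s)Q(s)| |P(s+1)²P(s−2)/(P(s)²P(s−1))|`", where `Q(s) = N Π (s+μ_j)/(2π)` is the analytic
conductor, `χ(s) = γ̄(1−s)/γ(s)` (so `L(s) = χ(s) L̄(1−s)`) and `P` collects the poles. For a primitive
Dirichlet character `χ` modulo `q > 1`: `r = 1`, `N = q`, `μ₁ = a = charParity χ`, `P = 1`, `L̄ = L(·, χ̄)`
(`χ̄ = χ⁻¹`), and the printed proof establishes precisely "`|F(s)| ≤ B|Q(s)|` for all `s` in the strip"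
for `F(s) := L(s)L̄(1−s) = χ(s)^{−1}L(s)²` ("Since `F` has finite order, it follows from the
Phragmén–Lindelöf theorem"), which is the form typed here (free of the `Γ`-quotient `χ(s)`, which has a
pole at `s = 1 + a`): `‖L(s, χ) L(1−s, χ̄)‖ ≤ B · q‖s + a‖/(2π)`. `B` is any bound for `|L(3/2+it, χ)|²`
(the printed `B` is the supremum). Proof as printed: on `Re s = 3/2`,
`|F| = |L(3/2+it)|²|Q(−1/2+it)| ≤ B|Q(3/2+it)|`; `|F(σ+it)| = |F(1−σ+it)|`; `F/Q` is holomorphic (the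
zero of `Q` at `s = −a` is a trivial zero of `L(s, χ)`; here `F/Q` is `dslope F (−a)`) and of finite order;
Phragmén–Lindelöf (the tree's `Rademacher.norm_le_interpolate` with exponents `0`).
[cite: Booker2006, §4 Lemma 4.1 and proof] -/
theorem booker2006_lemma41_dirichlet (hq : 1 < q) {χ : DirichletCharacter ℂ q} (hχ : χ.IsPrimitive)
    {B : ℝ} (hB : ∀ t : ℝ, ‖χ.LFunction (3 / 2 + t * I)‖ ^ 2 ≤ B)
    {s : ℂ} (h₁ : -1 / 2 ≤ s.re) (h₂ : s.re ≤ 3 / 2) :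
    ‖χ.LFunction s * χ⁻¹.LFunction (1 - s)‖ ≤ B * ((q : ℝ) * ‖s + charParity χ‖ / (2 * π)) := by
  have hq1 : q ≠ 1 := by omega
  have hqR : (0 : ℝ) < q := by exact_mod_cast (by omega : 0 < q)
  have hχ1 : χ ≠ 1 := SelbergDirichlet.ne_one_of_isPrimitive hq1 hχ
  have hχ1' : χ⁻¹ ≠ 1 := inv_ne_one.mpr hχ1
  have hχ' : χ⁻¹.IsPrimitive := SelbergDirichlet.isPrimitive_inv hχ
  set a : ℕ := charParity χ with ha
  have hainv : charParity χ⁻¹ = a := by rw [ha, DirichletTheta.charParity_inv]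
  have ha1 : a ≤ 1 := charParity_le_one χ
  have haR : (0 : ℝ) ≤ a := Nat.cast_nonneg a
  -- `F(s) = L(s, χ) L(1 - s, χ̄)`
  set F : ℂ → ℂ := fun z => χ.LFunction z * χ⁻¹.LFunction (1 - z) with hF
  have hFd : Differentiable ℂ F := (differentiable_LFunction hχ1).mul
    ((differentiable_LFunction hχ1').comp ((differentiable_const 1).sub differentiable_id))
  have hFa : F (-(a : ℂ)) = 0 := by
    simp only [hF, ha, LFunction_neg_charParity hq χ, zero_mul]
  -- `g = F/(s + a)`, holomorphic
  set g : ℂ → ℂ := dslope F (-(a : ℂ)) with hg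
  have hgF : ∀ z : ℂ, (z + a) * g z = F z := by
    intro z
    have h := sub_smul_dslope F (-(a : ℂ)) z
    rwa [smul_eq_mul, hFa, sub_zero, sub_neg_eq_add] at h
  have hgd : Differentiable ℂ g := by
    have h := (Complex.differentiableOn_dslope
      (univ_mem : (univ : Set ℂ) ∈ 𝓝 (-(a : ℂ)))).mpr hFd.differentiableOn
    exact differentiableOn_univ.mp h
  -- `B > 0`
  have hB0 : 0 < B := by
    have h := hB 0
    have hne : χ.LFunction (3 / 2 + (0 : ℝ) * I) ≠ 0 :=
      LFunction_ne_zero_of_one_le_re χ (Or.inl hχ1) (by simp; norm_num)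
    have : 0 < ‖χ.LFunction (3 / 2 + (0 : ℝ) * I)‖ ^ 2 := by positivity
    linarith
  set C : ℝ := B * (q / (2 * π)) with hC
  have hC0 : 0 < C := by positivity
  -- `|F|` on the two edges
  have hFright : ∀ z : ℂ, z.re = 3 / 2 → ‖F z‖ ≤ C * ‖z + a‖ := by
    intro z hz
    have hz' : (1 - z).re = -1 / 2 := by simp [hz]; norm_num
    have hrefl := norm_LFunction_left_edge hq hχ' hz'
    rw [hainv, inv_inv, sub_sub_cancel] at hrefl
    have hzeq : z = (3 / 2 : ℂ) + z.im * I := Complex.ext (by simp [hz]) (by simp)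
    have hL2 : ‖χ.LFunction z‖ ^ 2 ≤ B := by rw [hzeq]; exact hB z.im
    have hcmp : ‖1 - z + (a : ℂ)‖ ≤ ‖z + a‖ := by
      rw [Complex.norm_eq_sqrt_sq_add_sq, Complex.norm_eq_sqrt_sq_add_sq]
      apply Real.sqrt_le_sqrt
      simp only [Complex.add_re, Complex.sub_re, Complex.one_re, hz, Complex.natCast_re,
        Complex.add_im, Complex.sub_im, Complex.one_im, Complex.natCast_im]
      nlinarith
    calc ‖F z‖ = ‖χ.LFunction z‖ * ‖χ⁻¹.LFunction (1 - z)‖ := norm_mul _ _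
      _ = (q : ℝ) / (2 * π) * ‖1 - z + (a : ℂ)‖ * ‖χ.LFunction z‖ ^ 2 := by rw [hrefl]; ring
      _ ≤ (q : ℝ) / (2 * π) * ‖z + a‖ * B := by gcongr
      _ = C * ‖z + a‖ := by rw [hC]; ring
  have hFleft : ∀ z : ℂ, z.re = -1 / 2 → ‖F z‖ ≤ C * ‖z + a‖ := by
    intro z hz
    have hrefl := norm_LFunction_left_edge hq hχ hz
    have hconj : χ⁻¹.LFunction (1 - z) = (starRingEnd ℂ) (χ.LFunction ((3 / 2 : ℂ) + z.im * I)) := by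
      rw [← DirichletZFR.conj_LFunction_conj χ hχ1 (1 - z)]
      congr 2
      apply Complex.ext <;> norm_num [hz]
    have hL2 : ‖χ⁻¹.LFunction (1 - z)‖ ^ 2 ≤ B := by
      rw [hconj, Complex.norm_conj]; exact hB z.im
    calc ‖F z‖ = ‖χ.LFunction z‖ * ‖χ⁻¹.LFunction (1 - z)‖ := norm_mul _ _
      _ = (q : ℝ) / (2 * π) * ‖z + a‖ * ‖χ⁻¹.LFunction (1 - z)‖ ^ 2 := by rw [hrefl]; ring
      _ ≤ (q : ℝ) / (2 * π) * ‖z + a‖ * B := by gcongr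
      _ = C * ‖z + a‖ := by rw [hC]; ring
  -- hence `|g| ≤ C` on the edges (`z + a ≠ 0` there)
  have hg_edge : ∀ z : ℂ, (z.re = -1 / 2 ∨ z.re = 3 / 2) → ‖g z‖ ≤ C := by
    intro z hz
    have hFz : ‖F z‖ ≤ C * ‖z + a‖ := by
      rcases hz with h | h
      · exact hFleft z h
      · exact hFright z h
    have hza : 0 < ‖z + (a : ℂ)‖ := by
      refine norm_pos_iff.mpr fun h0 => ?_
      have := congrArg Complex.re h0
      simp at this
      rcases hz with h | h <;> rw [h] at this <;> interval_cases a <;> simp at this <;> linarith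
    have := hgF z
    rw [← this, norm_mul] at hFz
    nlinarith
  -- growth of `g` in the open strip
  set K₀ : ℝ := 25 * q * (∑' n : ℕ, ((n + 1 : ℕ) : ℝ) ^ (-(1 / 2 : ℝ) - 1)) with hK₀
  have hK₀0 : 0 ≤ K₀ := by positivity
  have hFgr : ∀ z : ℂ, -1 / 2 < z.re → z.re < 3 / 2 →
      ‖F z‖ ≤ K₀ ^ 2 * Real.exp ((58 * (q + 7)) * Real.exp (1 * |z.im|)) := by
    intro z hz1 hz2
    have hA := norm_LFunction_le_growth hq hχ (z := z) (by linarith) hz2.le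
    have hB' := norm_LFunction_le_growth hq hχ' (z := 1 - z) (by simp; linarith) (by simp; linarith)
    have him : |(1 - z).im| = |z.im| := by simp [abs_neg]
    rw [him] at hB'
    rw [one_mul]
    calc ‖F z‖ = ‖χ.LFunction z‖ * ‖χ⁻¹.LFunction (1 - z)‖ := norm_mul _ _
      _ ≤ (K₀ * Real.exp (29 * (q + 7) * Real.exp |z.im|)) *
          (K₀ * Real.exp (29 * (q + 7) * Real.exp |z.im|)) :=
          mul_le_mul hA hB' (norm_nonneg _) (by positivity)
      _ = K₀ ^ 2 * Real.exp ((58 * (q + 7)) * Real.exp |z.im|) := by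
          rw [sq, show (58 : ℝ) * (q + 7) * Real.exp |z.im| =
            29 * (q + 7) * Real.exp |z.im| + 29 * (q + 7) * Real.exp |z.im| by ring, Real.exp_add]
          ring
  -- a bound for `g` on the compact part `|Im z| ≤ 1` of the closed strip
  obtain ⟨M, hM⟩ : ∃ M : ℝ, ∀ z ∈ (Icc (-1 / 2 : ℝ) (3 / 2)) ×ℂ (Icc (-1 : ℝ) 1), ‖g z‖ ≤ M := by
    have hK : IsCompact ((Icc (-1 / 2 : ℝ) (3 / 2)) ×ℂ (Icc (-1 : ℝ) 1)) :=
      Metric.isCompact_of_isClosed_isBounded (IsClosed.reProdIm isClosed_Icc isClosed_Icc)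
        ((Metric.isBounded_Icc _ _).reProdIm (Metric.isBounded_Icc _ _))
    exact hK.exists_bound_of_continuousOn hgd.continuous.continuousOn
  have hgr : ∃ c < π / (3 / 2 - (-1 / 2 : ℝ)), ∃ K L : ℝ, ∀ z : ℂ, -1 / 2 < z.re → z.re < 3 / 2 →
      ‖g z‖ ≤ K * Real.exp (L * Real.exp (c * |z.im|)) := by
    refine ⟨1, ?_, max M 0 + K₀ ^ 2, 58 * (q + 7), fun z hz1 hz2 => ?_⟩
    · rw [lt_div_iff₀ (by norm_num)]; nlinarith [Real.pi_gt_three]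
    have hE : 1 ≤ Real.exp ((58 * (q + 7)) * Real.exp (1 * |z.im|)) := Real.one_le_exp (by positivity)
    rcases le_or_gt |z.im| 1 with hi | hi
    · have hz : z ∈ (Icc (-1 / 2 : ℝ) (3 / 2)) ×ℂ (Icc (-1 : ℝ) 1) :=
        ⟨⟨hz1.le, hz2.le⟩, abs_le.mp hi⟩
      have h1 := hM z hz
      have h2 : M ≤ max M 0 := le_max_left _ _
      have h3 : 0 ≤ K₀ ^ 2 := sq_nonneg _
      nlinarith [le_max_right M 0]
    · have hza : 1 ≤ ‖z + (a : ℂ)‖ := by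
        refine le_trans ?_ (Complex.abs_im_le_norm _)
        simp; exact hi.le
      have h1 : ‖g z‖ ≤ ‖F z‖ := by
        rw [← hgF z, norm_mul]
        exact le_mul_of_one_le_left (norm_nonneg _) hza
      have h2 := hFgr z hz1 hz2
      have h3 : 0 ≤ max M 0 := le_max_right _ _
      nlinarith
  -- Phragmén–Lindelöf (Rademacher's interpolation with exponents `0`)
  have hPL := Literature.Analysis.Complex.Rademacher.norm_le_interpolate (f := g)
    (a := -1 / 2) (b := 3 / 2) (Q := 1) (A := C) (B := C) (α := 0) (β := 0)
    (by norm_num) (by norm_num) hC0 hC0 le_rfl hgd.diffContOnCl hgr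
    (fun z hz => by rw [Real.rpow_zero, mul_one]; exact hg_edge z (Or.inl hz))
    (fun z hz => by rw [Real.rpow_zero, mul_one]; exact hg_edge z (Or.inr hz)) h₁ h₂
  rw [Real.rpow_zero, mul_one, ← Real.rpow_add hC0,
    show ((3 / 2 - s.re) / (3 / 2 - -1 / 2) + (s.re - -1 / 2) / (3 / 2 - -1 / 2) : ℝ) = 1 by
      field_simp; ring, Real.rpow_one] at hPL
  -- conclusion
  have := hgF s
  show ‖F s‖ ≤ _
  rw [← this, norm_mul]
  calc ‖s + (a : ℂ)‖ * ‖g s‖ ≤ ‖s + (a : ℂ)‖ * C := by gcongr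
    _ = B * ((q : ℝ) * ‖s + a‖ / (2 * π)) := by rw [hC]; ring

/-- **Booker's Lemma 4.1 on the critical line, degree one:** `|L(½+it, χ)|² ≤ B · q‖½ + a + it‖/(2π)`
(`= B|Q(½+it)|`; `|χ(½+it)| = 1`, `L̄(½−it) = conj L(½+it)`). [cite: Booker2006, §4 Lemma 4.1] -/
theorem booker2006_lemma41_dirichlet_criticalLine (hq : 1 < q) {χ : DirichletCharacter ℂ q}
    (hχ : χ.IsPrimitive) {B : ℝ} (hB : ∀ t : ℝ, ‖χ.LFunction (3 / 2 + t * I)‖ ^ 2 ≤ B) (t : ℝ) :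
    ‖χ.LFunction (1 / 2 + t * I)‖ ^ 2 ≤
      B * ((q : ℝ) * ‖(1 / 2 : ℂ) + charParity χ + t * I‖ / (2 * π)) := by
  have hq1 : q ≠ 1 := by omega
  have hχ1 : χ ≠ 1 := SelbergDirichlet.ne_one_of_isPrimitive hq1 hχ
  have h := booker2006_lemma41_dirichlet hq hχ hB (s := 1 / 2 + t * I) (by simp; norm_num)
    (by simp; norm_num)
  have hconj : χ⁻¹.LFunction (1 - (1 / 2 + t * I)) = (starRingEnd ℂ) (χ.LFunction (1 / 2 + t * I)) := by
    rw [← DirichletZFR.conj_LFunction_conj χ hχ1]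
    congr 2
    apply Complex.ext <;> norm_num
  rw [hconj, norm_mul, Complex.norm_conj, ← sq] at h
  convert h using 3
  ring

/-- **The majorant of Booker's Lemma 5.7 for Dirichlet `L`** ("Lemmas 4.1 and 4.5 imply the bound
`|F(t)| ≤ E`", `E = Z_θ(3/2)^r |γ(s)| e^{πrηt/4} |Q(s)|^{1/2}` with `P = 1`): on the critical line
`|L(½+it, χ)| ≤ ζ(3/2) (q‖½ + a + it‖/(2π))^{1/2} = Z₀(3/2)|Q(½+it)|^{1/2}` (`B = ζ(3/2)²` by Lemma 4.5,
the tree's `Booker2006Turing.norm_LFunction_le_bigZ`). [cite: Booker2006, §4 Lemmas 4.1, 4.5; §5.3 proof of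
Lemma 5.7] -/
theorem norm_LFunction_half_le_bigZ_mul_sqrt (hq : 1 < q) {χ : DirichletCharacter ℂ q}
    (hχ : χ.IsPrimitive) (t : ℝ) :
    ‖χ.LFunction (1 / 2 + t * I)‖ ≤ Booker2006Turing.bigZ (3 / 2) *
      Real.sqrt ((q : ℝ) * ‖(1 / 2 : ℂ) + charParity χ + t * I‖ / (2 * π)) := by
  have hZ : 0 < Booker2006Turing.bigZ (3 / 2) := Booker2006Turing.bigZ_pos (by norm_num)
  have hB : ∀ u : ℝ, ‖χ.LFunction (3 / 2 + u * I)‖ ^ 2 ≤ Booker2006Turing.bigZ (3 / 2) ^ 2 := by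
    intro u
    have h := Booker2006Turing.norm_LFunction_le_bigZ χ (σ := 3 / 2) (by norm_num) u
    push_cast at h
    exact pow_le_pow_left₀ (norm_nonneg _) h 2
  have h := booker2006_lemma41_dirichlet_criticalLine hq hχ hB t
  calc ‖χ.LFunction (1 / 2 + t * I)‖ = Real.sqrt (‖χ.LFunction (1 / 2 + t * I)‖ ^ 2) :=
        (Real.sqrt_sq (norm_nonneg _)).symm
    _ ≤ Real.sqrt (Booker2006Turing.bigZ (3 / 2) ^ 2 *
          ((q : ℝ) * ‖(1 / 2 : ℂ) + charParity χ + t * I‖ / (2 * π))) := Real.sqrt_le_sqrt h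
    _ = Booker2006Turing.bigZ (3 / 2) *
          Real.sqrt ((q : ℝ) * ‖(1 / 2 : ℂ) + charParity χ + t * I‖ / (2 * π)) := by
        rw [Real.sqrt_mul (sq_nonneg _), Real.sqrt_sq hZ.le]

end BookerConvexity

end Literature.NumberTheory.LFunctions

end
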